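import Summits.RiemannHypothesis.RiemannHypothesis.Theorems.LiTailLaguerreDefs
import Summits.RiemannHypothesis.RiemannHypothesis.Theorems.LiPrimeEchoPolarEdge
import Summits.RiemannHypothesis.RiemannHypothesis.Theorems.LiPrimeEchoEdgeTerms
import HarnessLib

/-!
# RiemannHypothesis / LiTailLaguerre — Assembly support `LiPolarTailBound`: the POLAR tail is `O(log n)` (RH-FREE)

RH-FREE [rh-li-eng-4].  Route `Theses/LiTailLaguerre.lean` (rung «Li TAIL–LAGUERRE LAW» `LiTheory.LiZeroTailLaguerre`,
L-P(P1-tail); cell `pub/rh-li`, theory round 7, dossier `theory/route/r7/`), the registered skeleton statement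
`Sig.stub_polar_tail` of the item `Assembly` (stmt-RiemannHypothesis-19706, birth stub `stub_polar_tail`) VERBATIM:
for every `c > 0` there are `N`, `C` with `|liPolarTail n T| ≤ C log n` whenever `n ≥ N` and `c√n ≤ T ≤ n`.

Here `liPolarTail n T = (1/π) Re ∫_T^∞ (1/w + 1/(w − 1)) (2 − k_n(w)) dy`, `w = 3/2 + iy`, `k_n(w) = F_n(w) + F_n(1 − w)`,
`F_n(s) = (1 − 1/s)ⁿ`.  Proof.  On the edge `|1/w + 1/(w − 1)| ≤ 2/y` (`PolarEdge.norm_polar_le`); the CO-WEIGHT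
`2 − k_n(w) = (1 − F_n(w)) + (1 − F_n(1 − w))` obeys two bounds for `y ≥ c√n`: the crude one `≤ 3 + e^{1/c²}`
(`|F_n(w)| ≤ 1`, `|F_n(1 − w)| = (1 + 2/(¼ + y²))^{n/2} ≤ e^{n/y²}`) and, by `1 − xⁿ = (1 − x)(1 + x + ⋯ + x^{n−1})` with
`|1 − x| ≤ 1/y` for both `x = 1 − 1/w` and `x = w/(w − 1) = 1 − 1/(1 − w)`, the decaying one `≤ n(1 + e^{1/c²})/y`; together
`≤ 2Kn/(y + n)` with `K = 3 + e^{1/c²}`, so the integrand is dominated by `4K(1/y − 1/(y + n))`, whose integral over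
`(T, ∞)` is `4K log(1 + n/T) ≤ 8K log n` (`integral_Ioi_of_hasDerivAt_of_nonneg'`; no measurability of the integrand is
needed: `norm_integral_le_of_norm_le`).  An elementary estimate; nothing here bears on the truth of RH.
-/

noncomputable section

-- D-0017: `Summit.<S>.<S>.…` is the designed namespace of a single-problem summit.
set_option linter.dupNamespace false

open Complex MeasureTheory Set Filter Topology

namespace Summit.RiemannHypothesis.RiemannHypothesis.Theorems.LiTheory

namespace PolarTail

/-! ### The right-edge point `w = 3/2 + iy` (`PrimeEdge.*` of `LiPrimeEchoEdgeTerms` for `w ≠ 0, 1` and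
`‖w‖² = y² + 9/4`, `‖w − 1‖² = y² + 1/4`) -/

/-- `y ≤ ‖3/2 + iy‖` for `y > 0`. -/
theorem le_norm_rightPt {y : ℝ} (hy : 0 < y) : y ≤ ‖liRightPt y‖ := by
  have := Complex.abs_im_le_norm (liRightPt y)
  simpa [liRightPt, abs_of_pos hy] using this

/-- `y ≤ ‖1/2 + iy‖` for `y > 0`. -/
theorem le_norm_rightPt_sub_one {y : ℝ} (hy : 0 < y) : y ≤ ‖liRightPt y - 1‖ := by
  have := Complex.abs_im_le_norm (liRightPt y - 1)
  simpa [liRightPt, abs_of_pos hy] using this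

/-- `|1 − 1/w| ≤ 1` on the right edge (`|w − 1| ≤ |w|`). -/
theorem norm_one_sub_inv_rightPt_le (y : ℝ) : ‖1 - 1 / liRightPt y‖ ≤ 1 := by
  have hq : 1 - 1 / liRightPt y = (liRightPt y - 1) / liRightPt y := by
    field_simp [PrimeEdge.liRightPt_ne_zero y]
  rw [hq, norm_div, div_le_one (norm_pos_iff.2 (PrimeEdge.liRightPt_ne_zero y))]
  have h1 : ‖liRightPt y - 1‖ ^ 2 ≤ ‖liRightPt y‖ ^ 2 := by
    rw [PrimeEdge.norm_liRightPt_sq, PrimeEdge.norm_liRightPt_sub_one_sq]; linarith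
  exact (pow_le_pow_iff_left₀ (norm_nonneg _) (norm_nonneg _) two_ne_zero).1 h1

/-- `1 − 1/(1 − w) = w/(w − 1)`. -/
theorem one_sub_inv_one_sub_rightPt (y : ℝ) :
    1 - 1 / (1 - liRightPt y) = liRightPt y / (liRightPt y - 1) := by
  field_simp [PrimeEdge.liRightPt_sub_one_ne_zero y, PrimeEdge.one_sub_liRightPt_ne_zero y]
  ring

/-- The ratio `q = |w/(w − 1)| ≥ 1` and, for `n ≤ κ y²`, `q^j ≤ e^κ` for every `j ≤ n`
(`q² = 1 + 2/(¼ + y²) ≤ 1 + 2κ/n`). -/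
theorem norm_ratio_pow_le (n j : ℕ) {y κ : ℝ} (hy : 0 < y) (hκ : 0 < κ) (hyn : (n : ℝ) ≤ κ * y ^ 2)
    (hj : j ≤ n) : ‖liRightPt y / (liRightPt y - 1)‖ ^ j ≤ Real.exp κ := by
  set q : ℝ := ‖liRightPt y / (liRightPt y - 1)‖ with hq
  have hq0 : 0 ≤ q := norm_nonneg _
  have hq2 : q ^ 2 = (y ^ 2 + 9 / 4) / (y ^ 2 + 1 / 4) := by
    rw [hq, norm_div, div_pow, PrimeEdge.norm_liRightPt_sq, PrimeEdge.norm_liRightPt_sub_one_sq]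
  have hq1 : 1 ≤ q := by
    have h1 : (1 : ℝ) ^ 2 ≤ q ^ 2 := by
      rw [hq2, one_pow, le_div_iff₀ (by positivity)]; linarith
    exact (pow_le_pow_iff_left₀ zero_le_one hq0 two_ne_zero).1 h1
  rcases Nat.eq_zero_or_pos n with hn | hn
  · subst hn
    have hj0 : j = 0 := Nat.le_zero.1 hj
    subst hj0
    rw [pow_zero]; exact Real.one_le_exp_iff.2 hκ.le
  have hn0 : (0 : ℝ) < n := by exact_mod_cast hn
  have hq2le : q ^ 2 ≤ 1 + 2 * κ / n := by
    rw [hq2, div_le_iff₀ (by positivity)]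
    have h2 : 2 ≤ 2 * κ / (n : ℝ) * (y ^ 2 + 1 / 4) := by
      rw [div_mul_eq_mul_div, le_div_iff₀ hn0]; nlinarith
    nlinarith
  have hexp : 1 + 2 * κ / (n : ℝ) ≤ Real.exp (2 * κ / n) := by
    have := Real.add_one_le_exp (2 * κ / (n : ℝ)); linarith
  have hpow : (q ^ 2) ^ n ≤ Real.exp κ ^ 2 := by
    calc (q ^ 2) ^ n ≤ (1 + 2 * κ / (n : ℝ)) ^ n := pow_le_pow_left₀ (sq_nonneg _) hq2le n
      _ ≤ Real.exp (2 * κ / n) ^ n := pow_le_pow_left₀ (by positivity) hexp n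
      _ = Real.exp (2 * κ) := by rw [← Real.exp_nat_mul]; congr 1; field_simp
      _ = Real.exp κ ^ 2 := by rw [← Real.exp_nat_mul]; norm_num
  have hsq : (q ^ n) ^ 2 ≤ Real.exp κ ^ 2 := by rw [← pow_mul, mul_comm, pow_mul]; exact hpow
  have hqn : q ^ n ≤ Real.exp κ :=
    (pow_le_pow_iff_left₀ (pow_nonneg hq0 n) (Real.exp_pos _).le two_ne_zero).1 hsq
  exact (pow_le_pow_right₀ hq1 hj).trans hqn

/-! ### Two bounds for the co-weight `2 − k_n(w)` on the right edge -/

/-- CRUDE bound: `‖2 − k_n(3/2 + iy)‖ ≤ 3 + e^κ` for `y > 0`, `n ≤ κ y²`. -/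
theorem norm_liCoSymWeight_le (n : ℕ) {y κ : ℝ} (hy : 0 < y) (hκ : 0 < κ) (hyn : (n : ℝ) ≤ κ * y ^ 2) :
    ‖liCoSymWeight n (liRightPt y)‖ ≤ 3 + Real.exp κ := by
  unfold liCoSymWeight liSymWeight liWeight
  rw [one_sub_inv_one_sub_rightPt]
  have h1 : ‖(1 - 1 / liRightPt y) ^ n‖ ≤ 1 := by
    rw [norm_pow]; exact pow_le_one₀ (norm_nonneg _) (norm_one_sub_inv_rightPt_le y)
  have h2 : ‖(liRightPt y / (liRightPt y - 1)) ^ n‖ ≤ Real.exp κ := by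
    rw [norm_pow]; exact norm_ratio_pow_le n n hy hκ hyn le_rfl
  calc ‖2 - ((1 - 1 / liRightPt y) ^ n + (liRightPt y / (liRightPt y - 1)) ^ n)‖
      ≤ ‖(2 : ℂ)‖ + ‖(1 - 1 / liRightPt y) ^ n + (liRightPt y / (liRightPt y - 1)) ^ n‖ := norm_sub_le _ _
    _ ≤ 2 + (1 + Real.exp κ) := by
        refine add_le_add (by simp) ((norm_add_le _ _).trans (add_le_add h1 h2))
    _ = 3 + Real.exp κ := by ring

/-- `‖1 − xⁿ‖ ≤ ‖1 − x‖ · n B` whenever `‖x‖^j ≤ B` for all `j < n` (geometric sum). -/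
theorem norm_one_sub_pow_le {x : ℂ} {B : ℝ} (n : ℕ) (hB : ∀ j < n, ‖x‖ ^ j ≤ B) :
    ‖1 - x ^ n‖ ≤ ‖1 - x‖ * (n * B) := by
  rw [← mul_neg_geom_sum x n, norm_mul]
  refine mul_le_mul_of_nonneg_left ?_ (norm_nonneg _)
  calc ‖∑ i ∈ Finset.range n, x ^ i‖ ≤ ∑ i ∈ Finset.range n, ‖x ^ i‖ := norm_sum_le _ _
    _ ≤ ∑ i ∈ Finset.range n, B :=
        Finset.sum_le_sum fun i hi ↦ by rw [norm_pow]; exact hB i (Finset.mem_range.1 hi)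
    _ = n * B := by rw [Finset.sum_const, Finset.card_range, nsmul_eq_mul]

/-- DECAY bound: `‖2 − k_n(3/2 + iy)‖ ≤ n(1 + e^κ)/y` for `y > 0`, `n ≤ κ y²` (the first-order terms of
`1 − F_n(w)` and `1 − F_n(1 − w)` are each `O(n/y)`). -/
theorem norm_liCoSymWeight_le_div (n : ℕ) {y κ : ℝ} (hy : 0 < y) (hκ : 0 < κ)
    (hyn : (n : ℝ) ≤ κ * y ^ 2) :
    ‖liCoSymWeight n (liRightPt y)‖ ≤ n * (1 + Real.exp κ) / y := by
  unfold liCoSymWeight liSymWeight liWeight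
  rw [one_sub_inv_one_sub_rightPt]
  set w := liRightPt y with hw
  have e : (2 : ℂ) - ((1 - 1 / w) ^ n + (w / (w - 1)) ^ n) = (1 - (1 - 1 / w) ^ n) + (1 - (w / (w - 1)) ^ n) := by
    ring
  rw [e]
  -- first piece: `x = 1 − 1/w`, `1 − x = 1/w`, `‖x‖ ≤ 1`
  have hA : ‖1 - (1 - 1 / w) ^ n‖ ≤ n / y := by
    have h := norm_one_sub_pow_le (x := 1 - 1 / w) (B := 1) n fun j _ ↦
      pow_le_one₀ (norm_nonneg _) (norm_one_sub_inv_rightPt_le y)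
    have h1 : ‖1 - (1 - 1 / w)‖ ≤ 1 / y := by
      rw [sub_sub_cancel, norm_div, norm_one]
      exact one_div_le_one_div_of_le hy (le_norm_rightPt hy)
    calc ‖1 - (1 - 1 / w) ^ n‖ ≤ ‖1 - (1 - 1 / w)‖ * (n * 1) := h
      _ ≤ 1 / y * (n * 1) := mul_le_mul_of_nonneg_right h1 (by positivity)
      _ = n / y := by ring
  -- second piece: `x = w/(w − 1)`, `1 − x = −1/(w − 1)`, `‖x‖^j ≤ e^κ`
  have hB : ‖1 - (w / (w - 1)) ^ n‖ ≤ n * Real.exp κ / y := by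
    have h := norm_one_sub_pow_le (x := w / (w - 1)) (B := Real.exp κ) n fun j hj ↦
      norm_ratio_pow_le n j hy hκ hyn hj.le
    have h1 : ‖1 - w / (w - 1)‖ ≤ 1 / y := by
      have hw1 : w - 1 ≠ 0 := PrimeEdge.liRightPt_sub_one_ne_zero y
      have e1 : (1 : ℂ) - w / (w - 1) = -(1 / (w - 1)) := by
        field_simp [hw1]
        ring
      rw [e1, norm_neg, norm_div, norm_one]
      exact one_div_le_one_div_of_le hy (le_norm_rightPt_sub_one hy)
    calc ‖1 - (w / (w - 1)) ^ n‖ ≤ ‖1 - w / (w - 1)‖ * (n * Real.exp κ) := h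
      _ ≤ 1 / y * (n * Real.exp κ) := mul_le_mul_of_nonneg_right h1 (by positivity)
      _ = n * Real.exp κ / y := by ring
  calc ‖(1 - (1 - 1 / w) ^ n) + (1 - (w / (w - 1)) ^ n)‖
      ≤ ‖1 - (1 - 1 / w) ^ n‖ + ‖1 - (w / (w - 1)) ^ n‖ := norm_add_le _ _
    _ ≤ n / y + n * Real.exp κ / y := add_le_add hA hB
    _ = n * (1 + Real.exp κ) / y := by ring

/-- The two bounds combined: `‖2 − k_n(3/2 + iy)‖ ≤ 2Kn/(y + n)`, `K = 3 + e^κ`. -/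
theorem norm_liCoSymWeight_le_combined (n : ℕ) {y κ : ℝ} (hy : 0 < y) (hκ : 0 < κ)
    (hyn : (n : ℝ) ≤ κ * y ^ 2) :
    ‖liCoSymWeight n (liRightPt y)‖ ≤ 2 * (3 + Real.exp κ) * n / (y + n) := by
  have hn : (0 : ℝ) ≤ n := n.cast_nonneg
  have hK : 0 ≤ 3 + Real.exp κ := by positivity
  rw [le_div_iff₀ (by positivity)]
  rcases le_or_gt y n with hyn' | hyn'
  · have h := norm_liCoSymWeight_le n hy hκ hyn
    calc ‖liCoSymWeight n (liRightPt y)‖ * (y + n) ≤ (3 + Real.exp κ) * (n + n) :=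
          mul_le_mul h (by linarith) (by positivity) hK
      _ = 2 * (3 + Real.exp κ) * n := by ring
  · have h := norm_liCoSymWeight_le_div n hy hκ hyn
    have h' : ‖liCoSymWeight n (liRightPt y)‖ * y ≤ n * (1 + Real.exp κ) := by
      rwa [le_div_iff₀ hy] at h
    have h0 : 0 ≤ ‖liCoSymWeight n (liRightPt y)‖ := norm_nonneg _
    nlinarith [mul_le_mul_of_nonneg_left hyn'.le h0]

/-- **Pointwise majorant of the polar-tail integrand** for `y ≥ c√n`-type heights (`n ≤ κ y²`, `y > 0`):
`‖(1/w + 1/(w − 1))(2 − k_n(w))‖ ≤ 4K(1/y − 1/(y + n))`, `K = 3 + e^κ`. -/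
theorem norm_polarTail_integrand_le (n : ℕ) {y κ : ℝ} (hy : 0 < y) (hκ : 0 < κ)
    (hyn : (n : ℝ) ≤ κ * y ^ 2) :
    ‖(1 / liRightPt y + 1 / (liRightPt y - 1)) * liCoSymWeight n (liRightPt y)‖ ≤
      4 * (3 + Real.exp κ) * (1 / y - 1 / (y + n)) := by
  have hn : (0 : ℝ) ≤ n := n.cast_nonneg
  rw [norm_mul]
  have h1 := PolarEdge.norm_polar_le hy
  have h2 := norm_liCoSymWeight_le_combined n hy hκ hyn
  have e : 4 * (3 + Real.exp κ) * (1 / y - 1 / (y + n)) = 2 / y * (2 * (3 + Real.exp κ) * n / (y + n)) := by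
    field_simp
    ring
  rw [e]
  exact mul_le_mul h1 h2 (norm_nonneg _) (by positivity)

/-! ### The majorant integrates to `4K log(1 + n/T)` over `(T, ∞)` -/

/-- `∫_T^∞ (1/y − 1/(y + n)) dy = log(T + n) − log T` for `T > 0` (and the integrand is integrable there). -/
theorem integral_majorant (n : ℕ) {T : ℝ} (hT : 0 < T) :
    IntegrableOn (fun y : ℝ ↦ 1 / y - 1 / (y + n)) (Ioi T) ∧
      ∫ y in Ioi T, (1 / y - 1 / (y + n)) = Real.log (T + n) - Real.log T := by
  have hn : (0 : ℝ) ≤ n := n.cast_nonneg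
  have hderiv : ∀ y ∈ Ici T, HasDerivAt (fun y : ℝ ↦ Real.log y - Real.log (y + n)) (1 / y - 1 / (y + n)) y := by
    intro y hy
    have hy0 : 0 < y := hT.trans_le hy
    have h1 : HasDerivAt (fun y : ℝ ↦ Real.log y) (1 / y) y := by
      rw [one_div]; exact Real.hasDerivAt_log hy0.ne'
    have h2 : HasDerivAt (fun y : ℝ ↦ Real.log (y + n)) (1 / (y + n)) y := by
      have := ((hasDerivAt_id y).add_const (n : ℝ)).log (by dsimp; linarith)
      simpa using this
    exact h1.sub h2
  have hpos : ∀ y ∈ Ioi T, 0 ≤ 1 / y - 1 / (y + (n : ℝ)) := by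
    intro y hy
    have hy0 : 0 < y := hT.trans hy
    rw [sub_nonneg]
    exact one_div_le_one_div_of_le hy0 (by linarith)
  have hlim : Tendsto (fun y : ℝ ↦ Real.log y - Real.log (y + n)) atTop (𝓝 0) := by
    have h1 : Tendsto (fun y : ℝ ↦ 1 + (n : ℝ) / y) atTop (𝓝 (1 + 0)) :=
      tendsto_const_nhds.add (tendsto_const_nhds.div_atTop tendsto_id)
    rw [add_zero] at h1
    have h2 : Tendsto (fun y : ℝ ↦ -Real.log (1 + (n : ℝ) / y)) atTop (𝓝 (-Real.log 1)) :=
      (h1.log one_ne_zero).neg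
    rw [Real.log_one, neg_zero] at h2
    refine h2.congr' ?_
    filter_upwards [eventually_gt_atTop 0] with y hy
    have e : 1 + (n : ℝ) / y = (y + n) / y := by field_simp
    rw [e, Real.log_div (by linarith) hy.ne']
    ring
  exact ⟨integrableOn_Ioi_deriv_of_nonneg' hderiv hpos hlim,
    by rw [integral_Ioi_of_hasDerivAt_of_nonneg' hderiv hpos hlim]; ring⟩

end PolarTail

open PolarTail in
/-- **Assembly support `LiPolarTailBound` of route `LiTailLaguerre` (registered skeleton statement
`Sig.stub_polar_tail` of stmt-RiemannHypothesis-19706, birth stub `stub_polar_tail`; RH-FREE):** for every `c > 0` there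
are `N`, `C` (here `C = 8(3 + e^{1/c²})`) such that `|liPolarTail n T| ≤ C log n` whenever `n ≥ N` and `c√n ≤ T ≤ n`.
Verbatim the registered statement. -/
theorem liPolarTailBound :
    ∀ c : ℝ, 0 < c → ∃ N : ℕ, ∃ C : ℝ, ∀ n : ℕ, N ≤ n → ∀ T : ℝ, c * Real.sqrt n ≤ T → T ≤ n →
      |liPolarTail n T| ≤ C * Real.log n := by
  intro c hc
  set K : ℝ := 3 + Real.exp (1 / c ^ 2) with hK
  have hK0 : 0 < K := by positivity
  refine ⟨⌈(c + 2 + 1 / c) ^ 2⌉₊, 8 * K, fun n hn T hTl hTu ↦ ?_⟩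
  -- sizes
  have hc1 : 0 < 1 / c := one_div_pos.2 hc
  have hN : (c + 2 + 1 / c) ^ 2 ≤ (n : ℝ) := (Nat.le_ceil _).trans (by exact_mod_cast hn)
  set s := Real.sqrt n with hs
  have hn0 : (0 : ℝ) ≤ n := by positivity
  have hss : s ^ 2 = n := by rw [hs, Real.sq_sqrt hn0]
  have hs3 : c + 2 + 1 / c ≤ s := by
    rw [hs, ← Real.sqrt_sq (by positivity : 0 ≤ c + 2 + 1 / c)]; exact Real.sqrt_le_sqrt hN
  have hs0 : 0 < s := by linarith
  have hcs1 : 1 ≤ c * s := by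
    have h1 : c * (1 / c) = 1 := mul_one_div_cancel hc.ne'
    nlinarith [mul_le_mul_of_nonneg_left hs3 hc.le]
  have hT0 : 0 < T := by linarith
  have hT1 : 1 ≤ T := hcs1.trans hTl
  have hn3 : (3 : ℝ) ≤ n := by nlinarith
  have hlogn1 : 1 ≤ Real.log n := by
    rw [Real.le_log_iff_exp_le (by linarith)]
    have := Real.exp_one_lt_d9; linarith
  -- the majorant and its integral
  have hκ : 0 < 1 / c ^ 2 := by positivity
  obtain ⟨hgi, hgv⟩ := integral_majorant n hT0
  have hbound : ∀ᵐ y ∂(volume.restrict (Ioi T)),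
      ‖(1 / liRightPt y + 1 / (liRightPt y - 1)) * liCoSymWeight n (liRightPt y)‖ ≤
        4 * K * (1 / y - 1 / (y + n)) := by
    refine ae_restrict_of_forall_mem measurableSet_Ioi fun y hy ↦ ?_
    have hy0 : 0 < y := hT0.trans hy
    have hyn : (n : ℝ) ≤ 1 / c ^ 2 * y ^ 2 := by
      have hy1 : c * s ≤ y := hTl.trans hy.le
      have h1 : (c * s) ^ 2 ≤ y ^ 2 := pow_le_pow_left₀ (by positivity) hy1 2
      rw [mul_pow, hss] at h1
      rw [div_mul_eq_mul_div, le_div_iff₀ (by positivity), one_mul]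
      linarith
    exact norm_polarTail_integrand_le n hy0 hκ hyn
  have hI := norm_integral_le_of_norm_le (hgi.const_mul (4 * K)) hbound
  rw [integral_const_mul, hgv] at hI
  -- `log(T + n) − log T ≤ 2 log n`
  have hlog : Real.log (T + n) - Real.log T ≤ 2 * Real.log n := by
    have h1 : Real.log (T + n) ≤ Real.log (2 * n) := Real.log_le_log (by linarith) (by linarith)
    have h2 : Real.log (2 * n) = Real.log 2 + Real.log n := Real.log_mul (by norm_num) (by linarith)
    have h3 : 0 ≤ Real.log T := Real.log_nonneg hT1
    have h4 : Real.log 2 ≤ 1 := by have := Real.log_two_lt_d9; linarith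
    linarith
  have hπ : 1 / Real.pi ≤ 1 := by
    rw [div_le_one Real.pi_pos]; linarith [Real.pi_gt_three]
  unfold liPolarTail
  rw [abs_mul, abs_of_pos (by positivity : (0 : ℝ) < 1 / Real.pi)]
  have hre := Complex.abs_re_le_norm
    (∫ y in Ioi T, (1 / liRightPt y + 1 / (liRightPt y - 1)) * liCoSymWeight n (liRightPt y))
  have hmain : ‖∫ y in Ioi T, (1 / liRightPt y + 1 / (liRightPt y - 1)) * liCoSymWeight n (liRightPt y)‖ ≤
      8 * K * Real.log n := by
    refine hI.trans ?_
    calc 4 * K * (Real.log (T + n) - Real.log T) ≤ 4 * K * (2 * Real.log n) :=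
          mul_le_mul_of_nonneg_left hlog (by positivity)
      _ = 8 * K * Real.log n := by ring
  calc 1 / Real.pi * |(∫ y in Ioi T, (1 / liRightPt y + 1 / (liRightPt y - 1)) * liCoSymWeight n (liRightPt y)).re|
      ≤ 1 * (8 * K * Real.log n) := mul_le_mul hπ (hre.trans hmain) (abs_nonneg _) zero_le_one
    _ = 8 * K * Real.log n := one_mul _

end Summit.RiemannHypothesis.RiemannHypothesis.Theorems.LiTheory

end
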